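import Literature.NumberTheory.LFunctions.Zhang2022.DetectorShiftLeadingCoeff

/-!
# Zhang (2022), programme F-S3 (cell landau-siegel §E, seat ls-barrier-p6): the leading coefficient of the
# shift-detector recipe stays POSITIVE UNDER DILATION — `0 < Re Σ_j W_j(z·b)` for every `z ∈ (0,1]`
# (criterion (C2), «no conjugate point», of the cell's exact PSD criterion, in its scalar form)

Y. Zhang, *Discrete mean estimates and the Landau–Siegel zero*, arXiv:2211.02515v1 [Zhang2022LandauSiegel] —
an unrefereed manuscript under adjudication. **WHAT THIS IS NOT: not a claim about Theorems 1–2 of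
arXiv:2211.02515, about Landau–Siegel zeros, or about Parity; nothing here asserts any claim of the manuscript.
The programme SEARCHES and TYPES; no claim about Landau–Siegel zeros, Theorems 1–2 of arXiv:2211.02515 or a
repaired Margin232 until a kernel theorem says so.**

Companion of `DetectorShiftLeadingCoeff` (`Det.re_sum_shiftW_eq`: the closed form
`c₀(b) := Re Σ_j W_j(b) = (2/(b₁−b₀))·[b₁ sin(πb₀/2) sin(π(b₂−b₁)/2)/(b₂−b₁) − b₀ sin(πb₁/2) sin(π(b₂−b₀)/2)/(b₂−b₀)]`
of the `‖g′‖²`-coefficient of the one-sided main-term form `𝔅_{R(b)}` of the three-shift detector recipe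
`Det.shiftRecipe b`, and `Det.re_sum_shiftW_pos`: `c₀(b) > 0` for every SIGN-ADMISSIBLE `b` — criterion (C1) of
the cell memo barrier/num/SHIFT-PSD.md §0.3 / H-CLOSED-FORM.md (I1)).

THIS FILE: **`c₀(z·b) > 0` for every DILATION `z ∈ (0,1]`** of a sorted triple with `0 < b₀ ≤ 1` and outer gap
`b₂ − b₁ ≤ 1` (`re_sum_shiftW_smul_pos`; in particular for every sign-admissible `b`,
`re_sum_shiftW_smul_pos_of_signAdmissible`). No integrality of the pair `[b₁, b₂]` is needed — only the two
band WIDTHS `b₀ ≤ 1`, `b₂ − b₁ ≤ 1`. WHY THE CELL WANTS IT (cell note barrier/p6/RESONANT-PLANE.md and INBOX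
2026-08-27T01:15Z; numerics there, not used here): the CLAMPED JACOBI DETERMINANT of the one-sided quadratic
problem `(π/2)𝔅_{R(b)} = c₀(b)·T_b(S) + (boundary form)` (`S = ∫_y^1 g`, clamped at `y = 1`) is, up to a
nowhere-vanishing factor, the numerator of `c₀` at the dilated triple `(1−y)·b`; so «no conjugate point on `(0,1]`»
— criterion (C2) of SHIFT-PSD.md §0.3, the hypothesis under which the exact Riccati (completion-of-squares)
certificate of `Det.formDetPSD_of_certificate` type exists — is exactly the statement proved here. The proof is the
dilation of the (I1) argument: with `q(x) := sin(πx/2)/x`, the bracket is `(zb₀)(zb₁)·[q(zb₀)q(zΔ) − q(zb₁)q(z(b₂−b₀))]`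
(`Δ = b₂ − b₁`); `q ≥ 1` on `(0,1]` (Jordan, `Real.le_sin_mul`), `q` is positive and strictly decreasing on `(0,2]`
(chords of the concave sine, `strictConcaveOn_sin_Icc`), and `|q(x)| ≤ 1/x`; if both `zb₁ < 2` and `z(b₂−b₀) < 2`
monotonicity gives the sign, otherwise one of the two right-hand factors is `≤ 1/2` and the other `≤ 1` in modulus
while the left product is `≥ 1`. Elementary real analysis; standard axioms; no numerics; no definitions.

References: Y. Zhang, arXiv:2211.02515v1 (2022), §2 Lemma 2.3 and (2.13) [p. 9]; Prop. 7.1 and its proof,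
(7.19)–(7.21) [pp. 44–47]. [cite: Zhang2022LandauSiegel, proof of Prop 7.1 (7.19)–(7.21)]
-/

noncomputable section

open Complex Real Set

namespace Literature.NumberTheory.LFunctions.Zhang2022

namespace Det

/-! ### Elementary facts about `q(x) = sin(πx/2)/x` -/

/-- Chord inequality of the concave sine, strict: `0 < X < Y ≤ π ⇒ X sin Y < Y sin X`. [folklore] -/
private theorem mul_sin_lt_mul_sin' {X Y : ℝ} (hX : 0 < X) (hXY : X < Y) (hY : Y ≤ π) :
    X * Real.sin Y < Y * Real.sin X := by
  have hY0 : 0 < Y := hX.trans hXY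
  have h := strictConcaveOn_sin_Icc.secant_strict_mono (a := 0) (x := X) (y := Y)
    ⟨le_rfl, Real.pi_pos.le⟩ ⟨hX.le, hXY.le.trans hY⟩ ⟨hY0.le, hY⟩ hX.ne' hY0.ne' hXY
  simp only [Real.sin_zero, sub_zero] at h
  rw [div_lt_iff₀ hY0, div_mul_eq_mul_div, lt_div_iff₀ hX] at h
  linarith

/-- `q` is strictly decreasing on `(0, 2]`: `0 < x < y ≤ 2 ⇒ sin(πy/2)/y < sin(πx/2)/x`. [folklore] -/
private theorem halfSinc_lt {x y : ℝ} (hx : 0 < x) (hxy : x < y) (hy : y ≤ 2) :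
    Real.sin (π / 2 * y) / y < Real.sin (π / 2 * x) / x := by
  have hπ := Real.pi_pos
  have hy0 : 0 < y := hx.trans hxy
  have h := mul_sin_lt_mul_sin' (X := π / 2 * x) (Y := π / 2 * y) (by positivity)
    (mul_lt_mul_of_pos_left hxy (by positivity)) (by nlinarith)
  -- `h : (π/2·x)·sin(π/2·y) < (π/2·y)·sin(π/2·x)`
  rw [div_lt_div_iff₀ hy0 hx]
  nlinarith

/-- `q > 0` on `(0, 2)`: `0 < sin(πx/2)` for `0 < x < 2`. [folklore] -/
private theorem sin_half_pos {x : ℝ} (hx : 0 < x) (hx2 : x < 2) : 0 < Real.sin (π / 2 * x) :=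
  Real.sin_pos_of_pos_of_lt_pi (by positivity) (by nlinarith [Real.pi_pos])

/-- `q ≥ 1` on `(0, 1]` (Jordan: `x ≤ sin(πx/2)`). [folklore] -/
private theorem one_le_halfSinc {x : ℝ} (hx : 0 < x) (hx1 : x ≤ 1) : 1 ≤ Real.sin (π / 2 * x) / x := by
  rw [le_div_iff₀ hx, one_mul]
  exact Real.le_sin_mul hx.le hx1

/-- `|q(x)| ≤ 1/x` for `x > 0`. [folklore] -/
private theorem abs_halfSinc_le {x : ℝ} (hx : 0 < x) : |Real.sin (π / 2 * x) / x| ≤ 1 / x := by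
  rw [abs_div, abs_of_pos hx]
  exact div_le_div_of_nonneg_right (Real.abs_sin_le_one _) hx.le

/-- **The key inequality.** For `0 < a ≤ 1`, `0 < d ≤ 1`, `a < m`, `d < M` with `M = m − a + d`:
`q(m)·q(M) < q(a)·q(d)`. [folklore] -/
private theorem halfSinc_key {a d m M : ℝ} (ha : 0 < a) (ha1 : a ≤ 1) (hd : 0 < d) (hd1 : d ≤ 1)
    (ham : a < m) (hdM : d < M) (hM : M = m - a + d) :
    Real.sin (π / 2 * m) / m * (Real.sin (π / 2 * M) / M)
      < Real.sin (π / 2 * a) / a * (Real.sin (π / 2 * d) / d) := by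
  have hm : 0 < m := ha.trans ham
  have hM0 : 0 < M := hd.trans hdM
  have hqa : 1 ≤ Real.sin (π / 2 * a) / a := one_le_halfSinc ha ha1
  have hqd : 1 ≤ Real.sin (π / 2 * d) / d := one_le_halfSinc hd hd1
  have hL : 1 ≤ Real.sin (π / 2 * a) / a * (Real.sin (π / 2 * d) / d) := by nlinarith
  by_cases hm2 : m < 2
  · by_cases hM2 : M < 2
    · -- all four arguments in `(0,2)`: monotonicity and positivity of `q`
      have h1 : Real.sin (π / 2 * m) / m < Real.sin (π / 2 * a) / a := halfSinc_lt ha ham hm2.le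
      have h2 : Real.sin (π / 2 * M) / M < Real.sin (π / 2 * d) / d := halfSinc_lt hd hdM hM2.le
      have p1 : 0 < Real.sin (π / 2 * m) / m := div_pos (sin_half_pos hm hm2) hm
      have p2 : 0 < Real.sin (π / 2 * M) / M := div_pos (sin_half_pos hM0 hM2) hM0
      calc Real.sin (π / 2 * m) / m * (Real.sin (π / 2 * M) / M)
          < Real.sin (π / 2 * a) / a * (Real.sin (π / 2 * M) / M) := mul_lt_mul_of_pos_right h1 p2
        _ ≤ Real.sin (π / 2 * a) / a * (Real.sin (π / 2 * d) / d) :=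
            mul_le_mul_of_nonneg_left h2.le (by linarith)
    · -- `M ≥ 2`: `|q(M)| ≤ 1/2`, and `m = M + a − d ≥ 1` so `|q(m)| ≤ 1`
      push Not at hM2
      have hm1 : 1 ≤ m := by linarith
      have b1 : |Real.sin (π / 2 * m) / m| ≤ 1 := (abs_halfSinc_le hm).trans (by
        rw [div_le_one hm]; exact hm1)
      have b2 : |Real.sin (π / 2 * M) / M| ≤ 1 / 2 := (abs_halfSinc_le hM0).trans (by
        rw [div_le_div_iff₀ hM0 two_pos]; linarith)
      have hprod : |Real.sin (π / 2 * m) / m * (Real.sin (π / 2 * M) / M)| ≤ 1 / 2 := by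
        rw [abs_mul]
        calc |Real.sin (π / 2 * m) / m| * |Real.sin (π / 2 * M) / M| ≤ 1 * (1 / 2) :=
              mul_le_mul b1 b2 (abs_nonneg _) zero_le_one
          _ = 1 / 2 := by ring
      have := (abs_le.mp hprod).2
      linarith
  · -- `m ≥ 2`: `|q(m)| ≤ 1/2`, and `M = m − a + d ≥ 1` so `|q(M)| ≤ 1`
    push Not at hm2
    have hM1 : 1 ≤ M := by linarith
    have b1 : |Real.sin (π / 2 * m) / m| ≤ 1 / 2 := (abs_halfSinc_le hm).trans (by
      rw [div_le_div_iff₀ hm two_pos]; linarith)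
    have b2 : |Real.sin (π / 2 * M) / M| ≤ 1 := (abs_halfSinc_le hM0).trans (by
      rw [div_le_one hM0]; exact hM1)
    have hprod : |Real.sin (π / 2 * m) / m * (Real.sin (π / 2 * M) / M)| ≤ 1 / 2 := by
      rw [abs_mul]
      calc |Real.sin (π / 2 * m) / m| * |Real.sin (π / 2 * M) / M| ≤ 1 / 2 * 1 :=
            mul_le_mul b1 b2 (abs_nonneg _) (by norm_num)
        _ = 1 / 2 := by ring
    have := (abs_le.mp hprod).2
    linarith

/-! ### `c₀` is positive at every dilation `z·b`, `z ∈ (0,1]` -/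

/-- **`0 < Re Σ_j W_j(z·b)` for every `z ∈ (0,1]`** when `0 < b₀ < b₁ < b₂`, `b₀ ≤ 1`, `b₂ − b₁ ≤ 1`: the leading
coefficient of the recipe form (`Det.re_sum_shiftW_eq`) stays positive under dilation of the shift triple — the
scalar content of «no conjugate point on `(0,1]`» for the one-sided E-010 problem (cell note RESONANT-PLANE.md /
INBOX 2026-08-27T01:15Z: the clamped Jacobi determinant at `y = 1 − z` is a unit times this numerator at `z·b`).
Only the two band widths enter, not the integrality of `[b₁, b₂]`.
[cite: Zhang2022LandauSiegel, §2 Lemma 2.3, (2.13); proof of Prop 7.1 (7.19)–(7.21)] -/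
theorem re_sum_shiftW_smul_pos {b : Fin 3 → ℝ} {z : ℝ} (h0 : 0 < b 0) (h01 : b 0 < b 1) (h12 : b 1 < b 2)
    (hb0 : b 0 ≤ 1) (hgap : b 2 - b 1 ≤ 1) (hz0 : 0 < z) (hz1 : z ≤ 1) :
    0 < (∑ j : Fin 3, shiftW (z • b) j).re := by
  have h02 : b 0 < b 2 := h01.trans h12
  have hz01 : z * b 0 < z * b 1 := mul_lt_mul_of_pos_left h01 hz0
  have hz12 : z * b 1 < z * b 2 := mul_lt_mul_of_pos_left h12 hz0
  have hz02 : z * b 0 < z * b 2 := mul_lt_mul_of_pos_left h02 hz0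
  rw [re_sum_shiftW_eq (z • b) (by simpa using hz01.ne) (by simpa using hz02.ne) (by simpa using hz12.ne)]
  simp only [Pi.smul_apply, smul_eq_mul]
  -- abbreviations
  set a : ℝ := z * b 0 with ha_def
  set m : ℝ := z * b 1 with hm_def
  set d : ℝ := z * b 2 - z * b 1 with hd_def
  set M : ℝ := z * b 2 - z * b 0 with hM_def
  have ha : 0 < a := by positivity
  have ha1 : a ≤ 1 := by rw [ha_def]; nlinarith
  have hd : 0 < d := by rw [hd_def]; linarith
  have hd1 : d ≤ 1 := by
    rw [hd_def, ← mul_sub]; nlinarith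
  have ham : a < m := hz01
  have hdM : d < M := by rw [hd_def, hM_def]; linarith
  have hM : M = m - a + d := by rw [hM_def, hm_def, ha_def, hd_def]; ring
  have hm : 0 < m := ha.trans ham
  have hM0 : 0 < M := hd.trans hdM
  have hma : 0 < m - a := sub_pos.mpr ham
  have key := halfSinc_key ha ha1 hd hd1 ham hdM hM
  -- the bracket equals `a·m·(q(a)q(d) − q(m)q(M))`
  have hbr : m * (Real.sin (π / 2 * a) * Real.sin (π / 2 * d)) / d
        - a * (Real.sin (π / 2 * m) * Real.sin (π / 2 * M)) / M
      = a * m * (Real.sin (π / 2 * a) / a * (Real.sin (π / 2 * d) / d)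
          - Real.sin (π / 2 * m) / m * (Real.sin (π / 2 * M) / M)) := by
    field_simp
  rw [show z * b 1 - z * b 0 = m - a by rw [hm_def, ha_def], hbr]
  have : 0 < a * m * (Real.sin (π / 2 * a) / a * (Real.sin (π / 2 * d) / d)
      - Real.sin (π / 2 * m) / m * (Real.sin (π / 2 * M) / M)) :=
    mul_pos (mul_pos ha hm) (sub_pos.mpr key)
  positivity

/-- **Every sign-admissible triple keeps `c₀ > 0` under dilation:** for `Det.SignAdmissible b` and `z ∈ (0,1]`,
`0 < Re Σ_j W_j(z·b)` (the outer gap of a sign-admissible triple is `≤ 1`: `k ≤ b₁ < b₂ ≤ k + 1`). At `z = 1` this is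
`Det.re_sum_shiftW_pos`. [cite: Zhang2022LandauSiegel, §2 Lemma 2.3, (2.13); proof of Prop 7.1 (7.19)–(7.21)] -/
theorem re_sum_shiftW_smul_pos_of_signAdmissible {b : Fin 3 → ℝ} (hb : SignAdmissible b) {z : ℝ}
    (hz0 : 0 < z) (hz1 : z ≤ 1) : 0 < (∑ j : Fin 3, shiftW (z • b) j).re := by
  obtain ⟨h0, h01, h12, hle1, k, hk1, hk2⟩ := hb
  exact re_sum_shiftW_smul_pos h0 h01 h12 hle1 (by linarith) hz0 hz1

/-- The same for the recipe's weight field at the dilated triple: `0 < Re Σ_j (shiftRecipe (z·b)).W j`.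
[cite: Zhang2022LandauSiegel, §2 Lemma 2.3, (2.13); proof of Prop 7.1 (7.19)–(7.21)] -/
theorem re_sum_shiftRecipe_W_smul_pos {b : Fin 3 → ℝ} (hb : SignAdmissible b) {z : ℝ}
    (hz0 : 0 < z) (hz1 : z ≤ 1) : 0 < (∑ j : Fin 3, (shiftRecipe (z • b)).W j).re := by
  simpa [shiftRecipe] using re_sum_shiftW_smul_pos_of_signAdmissible hb hz0 hz1

/-- In particular (z = 1, outer-gap form): `c₀(b) > 0` already for `0 < b₀ < b₁ < b₂`, `b₀ ≤ 1`, `b₂ − b₁ ≤ 1` —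
the WIDTH condition alone, without the lattice condition `[b₁,b₂] ⊂ [k,k+1]` of `Det.SignAdmissible` (the cell's
numerics locate PSD triples of this kind outside the sign-admissible set, RESONANT-PLANE.md §1).
[cite: Zhang2022LandauSiegel, proof of Prop 7.1 (7.19)–(7.21)] -/
theorem re_sum_shiftW_pos_of_widths {b : Fin 3 → ℝ} (h0 : 0 < b 0) (h01 : b 0 < b 1) (h12 : b 1 < b 2)
    (hb0 : b 0 ≤ 1) (hgap : b 2 - b 1 ≤ 1) : 0 < (∑ j : Fin 3, shiftW b j).re := by
  have h := re_sum_shiftW_smul_pos h0 h01 h12 hb0 hgap one_pos le_rfl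
  rwa [one_smul] at h

end Det

end Literature.NumberTheory.LFunctions.Zhang2022
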